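import Summits.SmoothPoincare4.SmoothPoincare4.Theorems.ConvexBisectionAcyclicBisectionExistsSeamTwistSignAmbient
import HarnessLib

/-!
# Seam transport, ST4 (4b, isotopies): fibred isotopies of the Lefschetz base have positive page
# determinant between flat page points
(wave 5, brick X3-2c of sub-node ST4 `node_ST4_twistSign` of node T3c-2 `node_seam_transport` of
stub `stub_T3_dualPresentation` (T3), line `modp-braid-orbits`, crux
`ConvexBisection.AcyclicBisectionExists`, item stmt-SmoothPoincare4-10508; registered sub-goal
`helper_pageDet_straighten_pos`)

The page determinant `pageDet g Λ q` (`…SeamTwistSignPageDet.lean`) of the ambient differential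
`Λ = ambDeriv g f x` (`…SeamTwistSignAmbient.lean`) of a FIBRED map `f` of `Base g` (preserving `rho`
and the direction of `w`) between FLAT page points is non-zero (`helper_ambDeriv_fibred`,
`pageDet_ne_zero`); its sign is the page-orientation character of `f` at `x`.  This file pins that
sign to `+1` for the maps occurring in ST4 WITHOUT any orientation theory of `∂ Base g` at bent points:

* §1 `pageDet_ambDeriv_isotopy_pos`: for a fibred ambient isotopy `F` of `Base g` and a flat page
  point `q` whose whole orbit `F_t q`, `t ∈ [0, 1]`, stays in flat pages, `pageDet (dF_1) q > 0` —
  the continuous (`continuous_ambDeriv_isotopy`) non-vanishing function `t ↦ pageDet (dF_t)_q` is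
  `‖τ‖² > 0` at `t = 0` (`pageDet_pos_of_path`);
* §2 `pageDet_comp_straighten_pos` (registered as `helper_pageDet_straighten_pos`): let `S` be the
  radial STRAIGHTENING isotopy of ST2 (restriction of an ambient fibred flow `θ` of `ℝ⁴`, flat pages
  forward invariant) and `R` ANY fibred ambient isotopy; let `p₀ ∈ ∂ Base g` (possibly in the bent
  part) with `R_1 p₀` flat and `S_1 (R_t p₀)` flat for `t ∈ [0, 1]`.  Then the fibred local
  diffeomorphism `R_1 ∘ S_{-1}` from the flat point `q = S_1 p₀` to the flat point `R_1 p₀` has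
  `pageDet > 0`: the conjugates `Θ_t = S_1 ∘ R_t ∘ S_{-1}` are flat-to-flat AT `q` for all `t`
  (`Θ_t q = S_1 (R_t p₀)`), `Θ_0 = id`, their ambient differentials
  `dS_1|_{R_t p₀} ∘ dR_t|_{p₀} ∘ dS_{-1}|_q` vary continuously (`θ` is `C¹`; `dR_t` at the FIXED point
  `p₀`), so `pageDet (dΘ_1) q > 0`; and `dΘ_1 = dS_1|_{R_1 p₀} ∘ d(R_1 ∘ S_{-1})|_q` with
  `pageDet (dS_1) > 0` at the flat point `R_1 p₀` by §1 — multiplicativity (`pageDet_comp`) concludes.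
  This is how ST4 compares the knot's own straightening `R` with a universal one.

Everything is proved; no named facts, no `sorry`.  References: J. B. Etnyre, T. Fuller, IMRN 2006,
Thm. 1 (proof, p. 8) [EtnyreFuller2006]; R. İ. Baykur, AGT 6 (2006), Thm. 5.1 (proof, p. 13)
[Baykur2006].
-/

noncomputable section

set_option linter.dupNamespace false

open scoped Manifold ContDiff Topology ComplexConjugate
open Set Function Complex
open Literature.Topology.FourManifolds Literature.Topology.FourManifolds.LefschetzBase

namespace Summit.SmoothPoincare4.SmoothPoincare4.Theorems.AcyclicBisectionExists.ModpBraidOrbits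

variable {g : ℕ}

/-! ## §1 A fibred isotopy has positive page determinant along a flat orbit -/

/-- Points of a page of unit direction are flat page points: `‖x‖² < 4` and `w = c/2 ≠ 0`.
[folklore] -/
theorem flat_of_mem_page {c : ℂ} (hc : ‖c‖ = 1) {q : Base g} (hq : q ∈ page g c) :
    ‖cx q.1‖ ^ 2 < 4 ∧ w g q.1 ≠ 0 := by
  refine ⟨hq.1, fun h0 => ?_⟩
  have e : w g q.1 = c / 2 := hq.2
  rw [h0] at e
  have : c = 0 := by linear_combination (-2) * e
  rw [this, norm_zero] at hc
  exact zero_ne_one hc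

/-- **The page determinant of the ambient differential of a fibred map between flat page points does
not vanish** (for a local diffeomorphism `f`). [cite: EtnyreFuller2006, Thm. 1 (proof, p. 8)] -/
theorem pageDet_ambDeriv_ne_zero {f : Base g → Base g} (hf : IsLocalDiffeomorph (𝓡∂ 4) (𝓡∂ 4) ∞ f)
    (hρ : ∀ y : Base g, rho g (f y).1 = rho g y.1)
    (hdir : ∀ y : Base g, ∃ r : ℝ, 0 < r ∧ w g (f y).1 = (r : ℂ) * w g y.1)
    {x : Base g} {c c' : ℂ} (hc : ‖c‖ = 1) (hc' : ‖c'‖ = 1) (hx : x ∈ page g c)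
    (hfx : f x ∈ page g c') : pageDet g (ambDeriv g f x) x.1 ≠ 0 := by
  obtain ⟨hflat, hw⟩ := flat_of_mem_page hc hx
  obtain ⟨hflat', -⟩ := flat_of_mem_page hc' hfx
  obtain ⟨-, hL⟩ := helper_ambDeriv_fibred g f x ((hf x).mdifferentiableAt (by simp)) hρ hdir hflat
    hflat' hw
  refine pageDet_ne_zero _ (coe_ne_zero x) (coe_ne_zero (f x)) (fun X _ hX0 => ?_)
    (hL _ (dPhi_pageVec _)) (hL _ (dPhi_cplxJ_pageVec _))
  exact injective_ambDeriv hf x (by rw [hX0, map_zero])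

/-- **A fibred ambient isotopy has positive page determinant along a flat orbit**: if `F` preserves
`rho` and the direction of `w` at all times and the orbit `F_t q`, `t ∈ [0, 1]`, of the flat page
point `q` stays in flat pages, then `0 < pageDet g (ambDeriv g (F 1) q) q`. [cite: EtnyreFuller2006, Thm. 1 (proof, p. 8)] -/
theorem pageDet_ambDeriv_isotopy_pos (F : AmbientIsotopy (𝓡∂ 4) (Base g))
    (hρ : ∀ (t : ℝ) (y : Base g), rho g (F.toFun t y).1 = rho g y.1)
    (hdir : ∀ (t : ℝ) (y : Base g), ∃ r : ℝ, 0 < r ∧ w g (F.toFun t y).1 = (r : ℂ) * w g y.1)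
    {q : Base g} {c : ℂ} (hc : ‖c‖ = 1) (hq : q ∈ page g c)
    (hflat : ∀ t ∈ Icc (0 : ℝ) 1, ∃ c' : ℂ, ‖c'‖ = 1 ∧ F.toFun t q ∈ page g c') :
    0 < pageDet g (ambDeriv g (F.toFun 1) q) q.1 := by
  refine pageDet_pos_of_path (Λ := fun t => ambDeriv g (F.toFun t) q) (q := fun _ => q.1) ?_ ?_ ?_
  · exact continuousOn_pageDet_family (continuous_ambDeriv_isotopy F q).continuousOn
      continuousOn_const
  · intro t ht
    obtain ⟨c', hc', hFt⟩ := hflat t ht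
    exact pageDet_ambDeriv_ne_zero (F.isLocalDiffeomorph t) (hρ t) (hdir t) hc hc' hq hFt
  · show 0 < pageDet g (ambDeriv g (F.toFun 0) q) q.1
    rw [F.map_zero, ambDeriv_id]
    exact pageDet_id (coe_ne_zero q)

/-! ## §2 Comparison of two straightenings: `pageDet (d(R_1 ∘ S_{-1})) > 0` -/

section Straighten

variable (R S : AmbientIsotopy (𝓡∂ 4) (Base g))
  (θ : ℝ × EuclideanSpace ℝ (Fin 4) → EuclideanSpace ℝ (Fin 4))
  (hθ : ContDiff ℝ ∞ θ) (hθ0 : ∀ x, θ (0, x) = x) (hflow : ∀ t s x, θ (t, θ (s, x)) = θ (t + s, x))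
  (hSθ : ∀ (t : ℝ) (x : Base g), (S.toFun t x).1 = θ (t, x.1))
  (hρS : ∀ t x, rho g (θ (t, x)) = rho g x)
  (hdirS : ∀ t x, ∃ r : ℝ, 0 < r ∧ w g (θ (t, x)) = (r : ℂ) * w g x)
  (hflatS : ∀ (t : ℝ) (x : Base g) (c : ℂ), 0 ≤ t → x ∈ page g c → S.toFun t x ∈ page g c)
  (hρR : ∀ (t : ℝ) (y : Base g), rho g (R.toFun t y).1 = rho g y.1)
  (hdirR : ∀ (t : ℝ) (y : Base g), ∃ r : ℝ, 0 < r ∧ w g (R.toFun t y).1 = (r : ℂ) * w g y.1)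

include hSθ hθ0 hflow in
/-- `S_{-1} ∘ S_1 = id` (flow property). [folklore] -/
theorem straighten_left_inv (y : Base g) : S.toFun (-1) (S.toFun 1 y) = y := by
  apply Subtype.ext
  rw [hSθ, hSθ, hflow]
  norm_num
  exact hθ0 _

include hSθ hθ0 hflow in
/-- `S_1 ∘ S_{-1} = id` (flow property). [folklore] -/
theorem straighten_right_inv (y : Base g) : S.toFun 1 (S.toFun (-1) y) = y := by
  apply Subtype.ext
  rw [hSθ, hSθ, hflow]
  norm_num
  exact hθ0 _

include hSθ hρS in
/-- `S` preserves `rho` on the base. [folklore] -/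
theorem rho_straighten (t : ℝ) (y : Base g) : rho g (S.toFun t y).1 = rho g y.1 := by
  rw [hSθ, hρS]

include hSθ hdirS in
/-- `S` preserves the direction of `w` on the base. [folklore] -/
theorem dir_straighten (t : ℝ) (y : Base g) :
    ∃ r : ℝ, 0 < r ∧ w g (S.toFun t y).1 = (r : ℂ) * w g y.1 := by
  rw [hSθ]; exact hdirS t y.1

include hSθ hθ in
/-- The ambient differential of a stage of `S` is the Fréchet derivative of the flow map; in
particular it depends continuously on the point. [folklore] -/
theorem ambDeriv_straighten (t : ℝ) (y : Base g) :
    ambDeriv g (S.toFun t) y = fderiv ℝ (fun x => θ (t, x)) y.1 :=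
  ambDeriv_eq_fderiv ((S.contMDiff_toFun t).mdifferentiableAt (by simp))
    (((hθ.comp (contDiff_const.prodMk contDiff_id)).differentiable (by simp)) y.1) (hSθ t)

/-- Compositions of direction-preserving maps preserve directions. [folklore] -/
theorem dir_comp {f h : Base g → Base g}
    (hf : ∀ y : Base g, ∃ r : ℝ, 0 < r ∧ w g (f y).1 = (r : ℂ) * w g y.1)
    (hh : ∀ y : Base g, ∃ r : ℝ, 0 < r ∧ w g (h y).1 = (r : ℂ) * w g y.1) (y : Base g) :
    ∃ r : ℝ, 0 < r ∧ w g ((f ∘ h) y).1 = (r : ℂ) * w g y.1 := by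
  obtain ⟨r₁, hr₁, h₁⟩ := hh y
  obtain ⟨r₂, hr₂, h₂⟩ := hf (h y)
  refine ⟨r₂ * r₁, mul_pos hr₂ hr₁, ?_⟩
  rw [Function.comp_apply, h₂, h₁]; push_cast; ring

include hθ hθ0 hflow hSθ hρS hdirS hflatS hρR hdirR in
/-- **Sub-goal `helper_pageDet_straighten_pos`, structured form**: with `S` the straightening isotopy
(ambient fibred flow `θ`, flat pages forward invariant), `R` a fibred ambient isotopy, `p₀` a point
with `R_1 p₀ ∈ page g c` and `S_1 (R_t p₀) ∈ page g c` for `t ∈ [0, 1]` (`‖c‖ = 1`), the page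
determinant of `d(R_1 ∘ S_{-1})` at the flat point `S_1 p₀` is positive. [cite: Baykur2006, Thm. 5.1 (proof, p. 13)] -/
theorem pageDet_comp_straighten_pos {p₀ : Base g} {c : ℂ} (hc : ‖c‖ = 1)
    (hS1 : ∀ t ∈ Icc (0 : ℝ) 1, S.toFun 1 (R.toFun t p₀) ∈ page g c)
    (hR1 : R.toFun 1 p₀ ∈ page g c) :
    0 < pageDet g (ambDeriv g (R.toFun 1 ∘ S.toFun (-1)) (S.toFun 1 p₀)) (S.toFun 1 p₀).1 := by
  set q := S.toFun 1 p₀ with hq_def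
  have hq0 : S.toFun (-1) q = p₀ := straighten_left_inv S θ hθ0 hflow hSθ p₀
  have hqflat : q ∈ page g c := by
    have := hS1 0 ⟨le_rfl, zero_le_one⟩
    rwa [R.map_zero] at this
  -- differentiability of the stages
  have hSd : ∀ (t : ℝ) (y : Base g), MDifferentiableAt (𝓡∂ 4) (𝓡∂ 4) (S.toFun t) y := fun t y =>
    (S.contMDiff_toFun t).mdifferentiableAt (by simp)
  have hRd : ∀ (t : ℝ) (y : Base g), MDifferentiableAt (𝓡∂ 4) (𝓡∂ 4) (R.toFun t) y := fun t y =>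
    (R.contMDiff_toFun t).mdifferentiableAt (by simp)
  -- the conjugates `Θ_t = S_1 ∘ R_t ∘ S_{-1}` and their ambient differentials at `q`
  set Θ : ℝ → Base g → Base g := fun t => S.toFun 1 ∘ R.toFun t ∘ S.toFun (-1) with hΘ
  set G : ℝ → (EuclideanSpace ℝ (Fin 4) →L[ℝ] EuclideanSpace ℝ (Fin 4)) :=
    fun t => ambDeriv g (Θ t) q with hG
  have hG_eq : ∀ t, G t = (ambDeriv g (S.toFun 1) (R.toFun t p₀)).comp
      ((ambDeriv g (R.toFun t) p₀).comp (ambDeriv g (S.toFun (-1)) q)) := by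
    intro t
    have h1 : ambDeriv g (R.toFun t ∘ S.toFun (-1)) q =
        (ambDeriv g (R.toFun t) p₀).comp (ambDeriv g (S.toFun (-1)) q) := by
      rw [ambDeriv_comp (by rw [hq0]; exact hRd t p₀) (hSd (-1) q), hq0]
    have h2 : ambDeriv g (S.toFun 1 ∘ (R.toFun t ∘ S.toFun (-1))) q =
        (ambDeriv g (S.toFun 1) ((R.toFun t ∘ S.toFun (-1)) q)).comp
          (ambDeriv g (R.toFun t ∘ S.toFun (-1)) q) :=
      ambDeriv_comp (hSd 1 _) ((hRd t _).comp q (hSd (-1) q))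
    show ambDeriv g (S.toFun 1 ∘ (R.toFun t ∘ S.toFun (-1))) q = _
    rw [h2, h1, Function.comp_apply, hq0]
  -- continuity of `t ↦ G t`
  have hGc : Continuous G := by
    have e : G = fun t => (ambDeriv g (S.toFun 1) (R.toFun t p₀)).comp
        ((ambDeriv g (R.toFun t) p₀).comp (ambDeriv g (S.toFun (-1)) q)) := funext hG_eq
    rw [e]
    have hθ1 : ContDiff ℝ ∞ fun x : EuclideanSpace ℝ (Fin 4) => θ (1, x) :=
      hθ.comp (contDiff_const.prodMk contDiff_id)
    have hpath : Continuous fun t : ℝ => (R.toFun t p₀).1 :=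
      continuous_subtype_val.comp (R.contMDiff.continuous.comp (continuous_id.prodMk continuous_const))
    have hA : Continuous fun t : ℝ => ambDeriv g (S.toFun 1) (R.toFun t p₀) := by
      have e1 : (fun t : ℝ => ambDeriv g (S.toFun 1) (R.toFun t p₀)) =
          fun t => fderiv ℝ (fun x => θ (1, x)) (R.toFun t p₀).1 :=
        funext fun t => ambDeriv_straighten S θ hθ hSθ 1 _
      rw [e1]
      exact (hθ1.continuous_fderiv (by simp)).comp hpath
    exact hA.clm_comp ((continuous_ambDeriv_isotopy R p₀).clm_comp continuous_const)
  -- `Θ_t` is fibred and flat-to-flat at `q`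
  have hΘρ : ∀ (t : ℝ) (y : Base g), rho g (Θ t y).1 = rho g y.1 := fun t y => by
    show rho g (S.toFun 1 (R.toFun t (S.toFun (-1) y))).1 = rho g y.1
    rw [rho_straighten S θ hSθ hρS, hρR, rho_straighten S θ hSθ hρS]
  have hΘdir : ∀ (t : ℝ) (y : Base g), ∃ r : ℝ, 0 < r ∧ w g (Θ t y).1 = (r : ℂ) * w g y.1 :=
    fun t => dir_comp (dir_straighten S θ hSθ hdirS 1)
      (dir_comp (hdirR t) (dir_straighten S θ hSθ hdirS (-1)))
  have hΘq : ∀ t, Θ t q = S.toFun 1 (R.toFun t p₀) := fun t => by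
    show S.toFun 1 (R.toFun t (S.toFun (-1) q)) = _
    rw [hq0]
  have hΘd : ∀ t, MDifferentiableAt (𝓡∂ 4) (𝓡∂ 4) (Θ t) q := fun t =>
    (hSd 1 _).comp q ((hRd t _).comp q (hSd (-1) q))
  -- non-vanishing of `pageDet (G t) q` on `[0, 1]`
  have hinjS : ∀ (t : ℝ) (y : Base g), Injective (ambDeriv g (S.toFun t) y) := fun t y =>
    injective_ambDeriv (S.isLocalDiffeomorph t) y
  have hinjR : ∀ (t : ℝ) (y : Base g), Injective (ambDeriv g (R.toFun t) y) := fun t y =>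
    injective_ambDeriv (R.isLocalDiffeomorph t) y
  have hne : ∀ t ∈ Icc (0 : ℝ) 1, pageDet g (G t) q.1 ≠ 0 := by
    intro t ht
    obtain ⟨hflat, hw⟩ := flat_of_mem_page hc hqflat
    have hflat' : ‖cx (Θ t q).1‖ ^ 2 < 4 := by rw [hΘq]; exact (hS1 t ht).1
    obtain ⟨-, hL⟩ := helper_ambDeriv_fibred g (Θ t) q (hΘd t) (hΘρ t) (hΘdir t) hflat hflat' hw
    refine pageDet_ne_zero _ (coe_ne_zero q) (coe_ne_zero (Θ t q)) (fun X _ hX0 => ?_)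
      (hL _ (dPhi_pageVec _)) (hL _ (dPhi_cplxJ_pageVec _))
    have hGX : G t X = 0 := hX0
    rw [hG_eq, ContinuousLinearMap.comp_apply, ContinuousLinearMap.comp_apply] at hGX
    have h1 := hinjS 1 _ (hGX.trans (map_zero _).symm)
    have h2 := hinjR t _ (h1.trans (map_zero _).symm)
    exact hinjS (-1) _ (h2.trans (map_zero _).symm)
  -- at `t = 0`, `Θ_0 = id`
  have hΘ0 : Θ 0 = id := by
    funext y
    show S.toFun 1 (R.toFun 0 (S.toFun (-1) y)) = y
    rw [R.map_zero, id, straighten_right_inv S θ hθ0 hflow hSθ]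
  have h0 : 0 < pageDet g (G 0) q.1 := by
    show 0 < pageDet g (ambDeriv g (Θ 0) q) q.1
    rw [hΘ0, ambDeriv_id]
    exact pageDet_id (coe_ne_zero q)
  have hpos : 0 < pageDet g (G 1) q.1 :=
    pageDet_pos_of_path (Λ := G) (q := fun _ => q.1)
      (continuousOn_pageDet_family hGc.continuousOn continuousOn_const) hne h0
  -- decompose `G 1 = dS_1|_{R_1 p₀} ∘ d(R_1 ∘ S_{-1})|_q`
  set q' := R.toFun 1 p₀ with hq'_def
  have hdec : G 1 = (ambDeriv g (S.toFun 1) q').comp (ambDeriv g (R.toFun 1 ∘ S.toFun (-1)) q) := by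
    show ambDeriv g (S.toFun 1 ∘ (R.toFun 1 ∘ S.toFun (-1))) q = _
    rw [ambDeriv_comp (hSd 1 _) ((hRd 1 _).comp q (hSd (-1) q)), Function.comp_apply, hq0]
  -- the inner map is fibred and flat-to-flat: `q ↦ q'`
  have hin_ρ : ∀ y : Base g, rho g ((R.toFun 1 ∘ S.toFun (-1)) y).1 = rho g y.1 := fun y => by
    rw [Function.comp_apply, hρR, rho_straighten S θ hSθ hρS]
  have hin_dir : ∀ y : Base g, ∃ r : ℝ, 0 < r ∧ w g ((R.toFun 1 ∘ S.toFun (-1)) y).1 = (r : ℂ) * w g y.1 :=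
    dir_comp (hdirR 1) (dir_straighten S θ hSθ hdirS (-1))
  have hin_q : (R.toFun 1 ∘ S.toFun (-1)) q = q' := by rw [Function.comp_apply, hq0]
  obtain ⟨hflat, hw⟩ := flat_of_mem_page hc hqflat
  have hflat' : ‖cx ((R.toFun 1 ∘ S.toFun (-1)) q).1‖ ^ 2 < 4 := by rw [hin_q]; exact hR1.1
  obtain ⟨-, hL⟩ := helper_ambDeriv_fibred g (R.toFun 1 ∘ S.toFun (-1)) q
    ((hRd 1 _).comp q (hSd (-1) q)) hin_ρ hin_dir hflat hflat' hw
  rw [hin_q] at hL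
  have hmult := pageDet_comp (ambDeriv g (R.toFun 1 ∘ S.toFun (-1)) q) (ambDeriv g (S.toFun 1) q')
    (coe_ne_zero q') (hL _ (dPhi_pageVec _)) (hL _ (dPhi_cplxJ_pageVec _))
  rw [← hdec] at hmult
  -- `pageDet (dS_1) q' > 0` by §1 (flat pages are forward invariant under `S`)
  have hS' : 0 < pageDet g (ambDeriv g (S.toFun 1) q') q'.1 :=
    pageDet_ambDeriv_isotopy_pos S (rho_straighten S θ hSθ hρS) (dir_straighten S θ hSθ hdirS) hc hR1
      fun t ht => ⟨c, hc, hflatS t q' c ht.1 hR1⟩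
  have hτ : 0 < ‖pageVec g q'.1‖ ^ 2 := by
    have := pageVec_ne_zero (g := g) (coe_ne_zero q'); positivity
  have hlhs : 0 < pageDet g (ambDeriv g (R.toFun 1 ∘ S.toFun (-1)) q) q.1 *
      pageDet g (ambDeriv g (S.toFun 1) q') q'.1 := by rw [← hmult]; positivity
  exact pos_of_mul_pos_left hlhs hS'.le

include hθ hθ0 hflow hSθ hρS hdirS hflatS hρR hdirR in
/-- The same positivity read through the knot's velocity: for a non-zero `T ∈ L_q`,
`0 < ⟪Λ(iT), iΛT⟫` for `Λ = d(R_1 ∘ S_{-1})|_q`. [cite: Baykur2006, Thm. 5.1 (proof, p. 13)] -/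
theorem inner_cplxJ_comp_straighten_pos {p₀ : Base g} {c : ℂ} (hc : ‖c‖ = 1)
    (hS1 : ∀ t ∈ Icc (0 : ℝ) 1, S.toFun 1 (R.toFun t p₀) ∈ page g c)
    (hR1 : R.toFun 1 p₀ ∈ page g c) {T : EuclideanSpace ℝ (Fin 4)} (hT : T ≠ 0)
    (hTL : dPhiX g (S.toFun 1 p₀).1 * cx T + dPhiY (S.toFun 1 p₀).1 * cy T = 0) :
    0 < inner ℝ (ambDeriv g (R.toFun 1 ∘ S.toFun (-1)) (S.toFun 1 p₀) (cplxJ T))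
      (cplxJ (ambDeriv g (R.toFun 1 ∘ S.toFun (-1)) (S.toFun 1 p₀) T)) := by
  obtain ⟨c₀, hc₀, e⟩ := inner_cplxJ_map_eq_mul_pageDet
    (ambDeriv g (R.toFun 1 ∘ S.toFun (-1)) (S.toFun 1 p₀)) (coe_ne_zero _) hT hTL
  rw [e]
  exact mul_pos hc₀ (pageDet_comp_straighten_pos R S θ hθ hθ0 hflow hSθ hρS hdirS hflatS hρR hdirR
    hc hS1 hR1)

end Straighten

/-- **Sub-goal `helper_pageDet_straighten_pos` of stub `stub_T3_dualPresentation`** (T3 ▸ T3c-2 ▸ ST4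
`node_ST4_twistSign`, brick X3-2c; wave 5, lead c5): for the straightening isotopy `S` of ST2
(restriction of a smooth fibred flow `θ` of `ℝ⁴`, flat pages forward invariant), any fibred ambient
isotopy `R` of `Base g`, and `p₀` with `R_1 p₀ ∈ page g c` and `S_1 (R_t p₀) ∈ page g c` for
`t ∈ [0, 1]` (`‖c‖ = 1`): the page determinant of the ambient differential of `R_1 ∘ S_{-1}` at the
flat point `S_1 p₀` is positive — the knot's straightening and the universal one induce the SAME
page-orientation character. [cite: Baykur2006, Thm. 5.1 (proof, p. 13)] -/
theorem helper_pageDet_straighten_pos : ∀ (g : ℕ) (R S : Literature.Topology.FourManifolds.AmbientIsotopy (𝓡∂ 4) (Literature.Topology.FourManifolds.LefschetzBase.Base g)) (θ : ℝ × EuclideanSpace ℝ (Fin 4) → EuclideanSpace ℝ (Fin 4)), ContDiff ℝ ∞ θ → (∀ x, θ (0, x) = x) → (∀ t s x, θ (t, θ (s, x)) = θ (t + s, x)) → (∀ (t : ℝ) (x : Literature.Topology.FourManifolds.LefschetzBase.Base g), (S.toFun t x).1 = θ (t, x.1)) → (∀ t x, Literature.Topology.FourManifolds.LefschetzBase.rho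 g (θ (t, x)) = Literature.Topology.FourManifolds.LefschetzBase.rho g x) → (∀ t x, ∃ r : ℝ, 0 < r ∧ Literature.Topology.FourManifolds.LefschetzBase.w g (θ (t, x)) = (r : ℂ) * Literature.Topology.FourManifolds.LefschetzBase.w g x) → (∀ (t : ℝ) (x : Literature.Topology.FourManifolds.LefschetzBase.Base g) (c : ℂ), 0 ≤ t → x ∈ Literature.Topology.FourManifolds.LefschetzBase.page g c → S.toFun t x ∈ Literature.Topology.FourManifolds.LefschetzBase.page g c) → (∀ (t : ℝ) (y : Literature.Topology.FourManifolds.LefschetzBase.Base g), Literature.Topology.FourManifolds.LefschetzBase.rho g (R.toFun t y).1 = Literature.Topology.FourManifolds.LefschetzBase.rho g y.1) → (∀ (t : ℝ) (y : Literature.Topology.FourManifolds.LefschetzBase.Base g), ∃ r : ℝ, 0 < r ∧ Literature.Topology.FourManifolds.LefschetzBase.w g (R.toFun t y).1 = (r : ℂ) * Literature.Topology.FourManifolds.LefschetzBase.w g y.1) → ∀ (p₀ : Literature.Topology.FourManifolds.LefschetzBase.Base g) (c : ℂ), ‖c‖ = 1 → (∀ t ∈ Set.Icc (0 : ℝ)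 1, S.toFun 1 (R.toFun t p₀) ∈ Literature.Topology.FourManifolds.LefschetzBase.page g c) → R.toFun 1 p₀ ∈ Literature.Topology.FourManifolds.LefschetzBase.page g c → 0 < Summit.SmoothPoincare4.SmoothPoincare4.Theorems.AcyclicBisectionExists.ModpBraidOrbits.pageDet g (Summit.SmoothPoincare4.SmoothPoincare4.Theorems.AcyclicBisectionExists.ModpBraidOrbits.ambDeriv g (R.toFun 1 ∘ S.toFun (-1)) (S.toFun 1 p₀)) (S.toFun 1 p₀).1 :=
  fun _ R S θ hθ hθ0 hflow hSθ hρS hdirS hflatS hρR hdirR _ _ hc hS1 hR1 =>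
    pageDet_comp_straighten_pos R S θ hθ hθ0 hflow hSθ hρS hdirS hflatS hρR hdirR hc hS1 hR1

end Summit.SmoothPoincare4.SmoothPoincare4.Theorems.AcyclicBisectionExists.ModpBraidOrbits

end
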